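import Mathlib
import Summits.MatrixMultiplication.MatrixMultiplication.Theses.SnSubsetDichotomy
import Literature.Barriers.MatrixMultiplication.YoungSubgroupBarrier

/-!
# Sketch — crux-ideate stmt-MatrixMultiplication-8303 (GlobalBranch), ideator 3, round 1

First lemmas of the three idea cards (they only need to ELABORATE; nothing here is proved):

* card `jordan-agreement-spectral-transfer`: `JordanAnticommutator`, `JordanTraceBound`,
  `AgreementMomentBound`, `HexagonTPP`, `SpectralPairWitness` (character form of Theorem A).
* card `bohr-confinement-relative-jordan`: `MarkovExtraction`, `HereditaryBumpBound`,
  `BlockBiasHexagonCounting` (the conjectural relative counting lemma, level 1), `MildBohrAgreement`.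
* card `frustration-packing-tradeoff`: `CosetPairPacking`, `YoungIntersectionProduct`,
  `YoungConfinedPairsLose`.
-/

set_option linter.dupNamespace false

namespace Summit.MatrixMultiplication.MatrixMultiplication.Cruxes.GlobalBranch.Sketch

open scoped ComplexOrder
open Finset
open Literature.Combinatorics.Additive
open Literature.RepresentationTheory.FiniteGroups

/-! ## Shared vocabulary -/

/-- The inner hypothesis of `GlobalBranch` for one set: all umvirate bumps up to level `√n` are at
most super-neutral, `|X ∩ U_{I→L}|·n^{(t)} ≤ n^{(1/2+ε)t}|X|`. -/
def BumpFree {n : ℕ} (ε : ℝ) (X : Finset (Equiv.Perm (Fin n))) : Prop :=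
  ∀ t : ℕ, 1 ≤ t → (t : ℝ) ≤ Real.sqrt (n : ℝ) → ∀ I L : Fin t → Fin n, Function.Injective I →
    Function.Injective L →
      ((X.filter (fun σ => ∀ k, σ (I k) = L k)).card : ℝ) * (n.descFactorial t : ℝ) ≤
        (n : ℝ) ^ ((1 / 2 + ε) * t) * (X.card : ℝ)

/-- Number of agreements (common fixed pattern) of two permutations: `agr σ τ = #{i : σ i = τ i}`
(= number of fixed points of the quotient `σ τ⁻¹`). -/
def agr {n : ℕ} (σ τ : Equiv.Perm (Fin n)) : ℕ := (univ.filter (fun i => σ i = τ i)).card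

/-- Hexagon count: solutions of `s s'⁻¹ t t'⁻¹ u u'⁻¹ = 1` in `S² × T² × U²`. -/
def hexagonCount {n : ℕ} (S T U : Finset (Equiv.Perm (Fin n))) : ℕ :=
  (((S ×ˢ S) ×ˢ ((T ×ˢ T) ×ˢ (U ×ˢ U))).filter
    (fun x => x.1.1 * x.1.2⁻¹ * (x.2.1.1 * x.2.1.2⁻¹) * (x.2.2.1 * x.2.2.2⁻¹) = 1)).card

/-! ## Card 1 — Jordan anticommutator positivity + agreement identity -/

/-- JORDAN LEMMA (matrix form): for positive semidefinite contractions `A, B` the anticommutator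
satisfies `AB + BA + ¼·1 ⪰ 0` (proof: `(A + B − ½)² ⪰ 0` and `A − A² ⪰ 0`, `B − B² ⪰ 0`). -/
def JordanAnticommutator : Prop :=
  ∀ (d : ℕ) (A B : Matrix (Fin d) (Fin d) ℂ), A.PosSemidef → B.PosSemidef →
    (1 - A).PosSemidef → (1 - B).PosSemidef →
      (A * B + B * A + (1 / 4 : ℂ) • (1 : Matrix (Fin d) (Fin d) ℂ)).PosSemidef

/-- Trace corollary (the lever): for PSD `X` and PSD contractions `Y, Z`,
`Re Tr(XYZ) ≥ −⅛ Tr X`; in the abelian (commuting) case the left side is `≥ 0`. -/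
def JordanTraceBound : Prop :=
  ∀ (d : ℕ) (X Y Z : Matrix (Fin d) (Fin d) ℂ), X.PosSemidef → Y.PosSemidef → Z.PosSemidef →
    (1 - Y).PosSemidef → (1 - Z).PosSemidef →
      -(1 / 8 : ℝ) * (X.trace).re ≤ ((X * Y * Z).trace).re

/-- AGREEMENT-MOMENT BOUND (elementary double counting): bump-freeness at level `t` bounds the
`t`-th factorial moment of agreements of two elements of `X`:
`Σ_{σ,τ∈X} (agr σ τ)^{(t)} = Σ_{I,L} |X ∩ U_{I→L}|² ≤ n^{(1/2+ε)t} |X|²`.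
(Representation-theoretically the left side is `|X|²·Σ_λ K_{λ,(n−t,1^t)} Tr P_X(λ)`, the
level-`≤ t` Fourier weight of the quotient law of `X`.) -/
def AgreementMomentBound : Prop :=
  ∀ (n t : ℕ) (ε : ℝ) (X : Finset (Equiv.Perm (Fin n))), 1 ≤ t →
    (∀ I L : Fin t → Fin n, Function.Injective I → Function.Injective L →
      ((X.filter (fun σ => ∀ k, σ (I k) = L k)).card : ℝ) * (n.descFactorial t : ℝ) ≤
        (n : ℝ) ^ ((1 / 2 + ε) * t) * (X.card : ℝ)) →
    (∑ σ ∈ X, ∑ τ ∈ X, (((agr σ τ).descFactorial t : ℕ) : ℝ)) ≤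
      (n : ℝ) ^ ((1 / 2 + ε) * t) * (X.card : ℝ) ^ 2

/-- TPP ⇔ only the trivial hexagons (`s = s'`, `t = t'`, `u = u'`). -/
def HexagonTPP : Prop :=
  ∀ (n : ℕ) (S T U : Finset (Equiv.Perm (Fin n))),
    TripleProductProperty S T U ↔ hexagonCount S T U = S.card * T.card * U.card

/-- THEOREM A, character form (the card's transfer statement; `D` plays `d_{t₀}`): a bump-free TPP
triple with `|S||T||U| ≥ 4(n!)^{3/2}/√D + 4·n!` has, for the pair `(T,U)`, an irreducible character
`χ ≠ 1` of degree `< D` on which BOTH quotient laws have polynomially large mass: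
`E[χ(t t'⁻¹)] · E[χ(u u'⁻¹)] ≥ D⁻⁴` (both factors are `Tr P ≥ 0`). Derived from the hexagon identity,
BNP on degrees `≥ D`, `JordanTraceBound` charging `Tr P_S`, and `AgreementMomentBound` for `S`. -/
def SpectralPairWitness : Prop :=
  ∀ ε : ℝ, 0 < ε → ε < 1 / 4 → ∃ n₀ : ℕ, ∀ n ≥ n₀, ∀ D : ℝ, 2 ≤ D → D ≤ Real.exp (Real.sqrt (n : ℝ)) →
    ∀ S T U : Finset (Equiv.Perm (Fin n)), TripleProductProperty S T U →
      BumpFree ε S → BumpFree ε T → BumpFree ε U →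
      4 * (n.factorial : ℝ) ^ ((3 : ℝ) / 2) / Real.sqrt D + 4 * (n.factorial : ℝ) ≤
        ((S.card * T.card * U.card : ℕ) : ℝ) →
      ∃ χ ∈ irrChars (Equiv.Perm (Fin n)), 1 < (χ 1).re ∧ (χ 1).re < D ∧
        D ^ (-(4 : ℝ)) ≤
          ((∑ t ∈ T, ∑ t' ∈ T, χ (t * t'⁻¹)).re / (T.card : ℝ) ^ 2) *
            ((∑ u ∈ U, ∑ u' ∈ U, χ (u * u'⁻¹)).re / (U.card : ℝ) ^ 2)

/-! ## Card 2 — hereditary Bohr localisation -/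

/-- MARKOV EXTRACTION: a bounded test function with mean `≥ η` on `X` is `≥ η/2` on at least an
`η/2`-fraction of `X` (the structured part is extractable at polynomial cost). -/
def MarkovExtraction : Prop :=
  ∀ (α : Type) (X : Finset α) (F : α → ℝ) (η : ℝ), 0 ≤ η → (∀ x ∈ X, F x ≤ 1) →
    η * (X.card : ℝ) ≤ ∑ x ∈ X, F x →
      η / 2 * (X.card : ℝ) ≤ ((X.filter (fun x => η / 2 ≤ F x)).card : ℝ)

/-- HEREDITY OF THE HYPOTHESIS: a subset `X' ⊆ X` of a bump-free set is bump-free up to the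
factor `|X|/|X'|` (so sub-selections of relative size `n^{-O(ℓ)}`, `ℓ ≤ √n/log n`, stay inside an
`e^{O(√n)}` budget); TPP itself is hereditary (`TripleProductProperty.mono`). -/
def HereditaryBumpBound : Prop :=
  ∀ (n t : ℕ) (ε : ℝ) (X X' : Finset (Equiv.Perm (Fin n))), X' ⊆ X →
    ∀ I L : Fin t → Fin n,
      ((X.filter (fun σ => ∀ k, σ (I k) = L k)).card : ℝ) * (n.descFactorial t : ℝ) ≤
          (n : ℝ) ^ ((1 / 2 + ε) * t) * (X.card : ℝ) →
        ((X'.filter (fun σ => ∀ k, σ (I k) = L k)).card : ℝ) * (n.descFactorial t : ℝ) ≤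
          (n : ℝ) ^ ((1 / 2 + ε) * t) * (X.card : ℝ)

/-- Block-bias Bohr set at level 1: permutations sending at least `n/4 + θ` points of `I` into `J`. -/
def blockBias {n : ℕ} (I J : Finset (Fin n)) (θ : ℕ) : Finset (Equiv.Perm (Fin n)) :=
  univ.filter (fun x => n / 4 + θ ≤ ((I.image x) ∩ J).card)

/-- RELATIVE COUNTING LEMMA (conjectural residual crux of card 2, level-1 instance): three MILD
block-bias Bohr sets (`θᵢ ≤ n^{1−δ}`, half-size blocks) contain at least half the generic number
`|L₀|²|L₁|²|L₂|²/n!` of hexagons — bias decays along the six-fold product unless the Bohr sets are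
cosets (`θ = n/4`, excluded by mildness). -/
def BlockBiasHexagonCounting : Prop :=
  ∃ δ : ℝ, 0 < δ ∧ ∃ n₀ : ℕ, ∀ n ≥ n₀, ∀ I J : Fin 3 → Finset (Fin n), ∀ θ : Fin 3 → ℕ,
    (∀ i, 2 * (I i).card = n ∧ 2 * (J i).card = n ∧ ((θ i : ℕ) : ℝ) ≤ (n : ℝ) ^ (1 - δ)) →
      (((blockBias (I 0) (J 0) (θ 0)).card : ℝ) ^ 2 * ((blockBias (I 1) (J 1) (θ 1)).card : ℝ) ^ 2 *
          ((blockBias (I 2) (J 2) (θ 2)).card : ℝ) ^ 2 / (n.factorial : ℝ)) / 2 ≤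
        (hexagonCount (blockBias (I 0) (J 0) (θ 0)) (blockBias (I 1) (J 1) (θ 1))
          (blockBias (I 2) (J 2) (θ 2)) : ℝ)

/-- MILD BOHR SETS HAVE POISSON AGREEMENTS (card `bohr-confinement-relative-jordan`): two random
elements of a mild block-bias set agree in `1 + O((θ+√n)²/n²)` places on average — so confinement
into a mild Bohr set certifies that the charged trace `Tr P_L(std) = E[agr] − 1` is `O(n^{-1/2})`
at `θ = n^{3/4}`, far below the crude bump bound `n^{1/2+ε}` that causes the ε-leak. -/
def MildBohrAgreement : Prop :=
  ∃ C : ℝ, 0 < C ∧ ∃ n₀ : ℕ, ∀ n ≥ n₀, ∀ (I J : Finset (Fin n)) (θ : ℕ),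
    2 * I.card = n → 2 * J.card = n → (blockBias I J θ).Nonempty →
      (∑ x ∈ blockBias I J θ, ∑ x' ∈ blockBias I J θ, (agr x x' : ℝ)) ≤
        (1 + C * (((θ : ℝ) + Real.sqrt (n : ℝ)) / (n : ℝ)) ^ 2) * ((blockBias I J θ).card : ℝ) ^ 2

/-! ## Card 3 — frustration–packing trade-off for coset-confined pairs -/

/-- COSET PAIR PACKING (the BCCGU engine for SUBSETS): if `S ⊆ gK`, `T ⊆ g'K'` and `(s,t) ↦ s⁻¹t`
is injective on `S × T` (e.g. `(S,T,U)` TPP with `U ≠ ∅`), then `S⁻¹T ⊆ K h K'` (`h = g⁻¹g'`), so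
`|S||T|·|K ∩ hK'h⁻¹| ≤ |K||K'|`. -/
def CosetPairPacking : Prop :=
  ∀ (G : Type) [Group G] [Fintype G] [DecidableEq G] (K K' : Subgroup G) (g g' : G)
    (S T U : Finset G), TripleProductProperty S T U → U.Nonempty →
      (∀ s ∈ S, g⁻¹ * s ∈ K) → (∀ t ∈ T, g'⁻¹ * t ∈ K') →
        S.card * T.card * Nat.card ↥(K ⊓ K'.map (MulAut.conj (g⁻¹ * g')).toMonoidHom) ≤
          Nat.card K * Nat.card K'

/-- YOUNG INTERSECTION PRODUCT: two Young subgroups all of whose blocks have size `≥ (1+δ)√n`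
(the only Young hosts of threshold size, `b ≥ √(e·n)`) intersect in a subgroup of order
`≥ 2^{δ n/2}` (cells of the common refinement average `> (1+δ)²` points; log-convexity of `k!`). -/
def YoungIntersectionProduct : Prop :=
  ∀ δ : ℝ, 0 < δ → δ ≤ 1 / 3 → ∃ n₀ : ℕ, ∀ n ≥ n₀, ∀ f g : Fin n → ℕ,
    (∀ a ∈ Set.range f, (1 + δ) * Real.sqrt (n : ℝ) ≤ ((univ.filter (fun i => f i = a)).card : ℝ)) →
    (∀ a ∈ Set.range g, (1 + δ) * Real.sqrt (n : ℝ) ≤ ((univ.filter (fun i => g i = a)).card : ℝ)) →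
      (2 : ℝ) ^ (δ * n / 2) ≤
        (Nat.card ↥(Literature.Barriers.MatrixMultiplication.youngSubgroup f ⊓
          Literature.Barriers.MatrixMultiplication.youngSubgroup g) : ℝ)

/-- Consequence (provable from the two above): pairs confined to cosets of threshold-size Young
subgroups lose `e^{-Ω(n)}` in packing — the "√n-block Young configurations" named in the crux are
sub-threshold for an elementary reason, with no use of the triple condition. -/
def YoungConfinedPairsLose : Prop :=
  ∀ δ : ℝ, 0 < δ → δ ≤ 1 / 3 → ∃ n₀ : ℕ, ∀ n ≥ n₀, ∀ f f' : Fin n → ℕ, ∀ g g' : Equiv.Perm (Fin n),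
    (∀ a ∈ Set.range f, (1 + δ) * Real.sqrt (n : ℝ) ≤ ((univ.filter (fun i => f i = a)).card : ℝ)) →
    (∀ a ∈ Set.range f', (1 + δ) * Real.sqrt (n : ℝ) ≤ ((univ.filter (fun i => f' i = a)).card : ℝ)) →
    ∀ S T U : Finset (Equiv.Perm (Fin n)), TripleProductProperty S T U → U.Nonempty →
      (∀ s ∈ S, g⁻¹ * s ∈ Literature.Barriers.MatrixMultiplication.youngSubgroup f) →
      (∀ t ∈ T, g'⁻¹ * t ∈ Literature.Barriers.MatrixMultiplication.youngSubgroup f') →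
        ((S.card * T.card : ℕ) : ℝ) * (2 : ℝ) ^ (δ * n / 2) ≤
          (Nat.card ↥(Literature.Barriers.MatrixMultiplication.youngSubgroup f) : ℝ) *
            (Nat.card ↥(Literature.Barriers.MatrixMultiplication.youngSubgroup f') : ℝ)

/-! ## How the cards would conclude the crux (shape only; no skeleton at this stage) -/

/-- The crux, by name. -/
example : Prop := Summit.MatrixMultiplication.MatrixMultiplication.Theses.SnSubsetDichotomy.GlobalBranch

end Summit.MatrixMultiplication.MatrixMultiplication.Cruxes.GlobalBranch.Sketch
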